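import Literature.Combinatorics.LorentzianPolynomials.PottsModelLorentzian
import Literature.Combinatorics.LorentzianPolynomials.MasonUltraLogConcave
import HarnessLib

/-!
# The Tutte-polynomial coefficients `c_q^k(M) = Σ_{|A|=k} q^{rk[n] - rk(A)}` are ultra log-concave for `0 < q ≤ 1`
# (Brändén–Huh 2020, §4.3, the remark after Thm. 4.14)

Layer `Literature/Combinatorics/LorentzianPolynomials`, namespace `Literature.Combinatorics.LorentzianPolynomials`;
lane `lit-hodgefound` (Track 2 foundations library), seat p16, generation 28 (row g28-#9). Brändén–Huh close §4.3 with
an application of Theorem 4.10 (`Z_{q,M}` Lorentzian, `PottsModelLorentzian.lean`) to the Tutte polynomial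
`T_M(x,y) = Σ_{A ⊆ [n]} (x-1)^{rk[n]-rk(A)} (y-1)^{|A|-rk(A)}`: writing
`w^{rk[n]} T_M(1 + q/w, 1 + w) = Σ_k c_q^k(M) w^k` with `c_q^k(M) = Σ_{A ∈ [n choose k]} q^{rk[n]-rk(A)}`, "the sequence
`c_q^k(M)` is ultra log-concave whenever `0 ≤ q ≤ 1`". The mechanism is that of Thm. 4.14 (`MasonUltraLogConcave.lean`):
setting `w_1 = ⋯ = w_n` in `Z_{q,M}` (the substitution `rename toBivariate`, Thm. 2.10) gives the bivariate Lorentzian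
polynomial `Σ_k Z^k_{q,M}(1,…,1) X_0^k X_1^{n-k}` with `Z^k_{q,M}(1,…,1) = Σ_{|A|=k} q^{-rk(A)} = q^{-rk[n]} c_q^k(M)`, and a
bivariate polynomial with nonnegative coefficients is Lorentzian iff its coefficient sequence is ultra log-concave with no
internal zeros (Example 2.26, `bivariate_mem_lorentzian_iff`). Here `0 < q ≤ 1`; the endpoint `q = 0` of the printed
remark (`c_0^k(M)` = the number of spanning `k`-subsets, the dual form of Thm. 4.14) is a limit statement not covered by
Thm. 4.10 itself; it is treated in §4 for matroids whose ground set is all of `σ`, as the dual form of Thm. 4.14: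
`c_0^k(M) = #{A : |A| = k, rk A = rk [n]}` counts the spanning `k`-sets, i.e. the complements of the independent
`(n-k)`-sets of `M✶`, and ultra log-concavity is symmetric under `k ↦ n - k` (g28 addendum).

## Source (verbatim) — P. Brändén, J. Huh, *Lorentzian polynomials* [BrandenHuh2019] (held `paper:arxiv-1902.03719`)

§4.3 (after the proof of Thm. 4.14): "The Tutte polynomial of a matroid `M` on `[n]` is the bivariate polynomial
`T_M(x,y) = Σ_{A ⊆ [n]} (x-1)^{rk_M([n]) - rk_M(A)} (y-1)^{|A| - rk_M(A)}`. Theorem 4.10 reveals several nontrivial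
inequalities satisfied by the coefficients of the Tutte polynomial. For example, if we write
`w^{rk_M([n])} T_M(1 + q/w, 1 + w) = Σ_{k=0}^n (Σ_{A ∈ [n choose k]} q^{rk_M([n]) - rk_M(A)}) w^k = Σ_{k=0}^n c_q^k(M) w^k`,
then the sequence `c_q^k(M)` is ultra log-concave whenever `0 ≤ q ≤ 1`." — with §4.3 proof of Thm. 4.14: "by Theorem
2.10, the bivariate polynomial obtained from `f_M` by setting `w_1 = ⋯ = w_n` is Lorentzian. The conclusion follows from
the fact that a bivariate homogeneous polynomial with nonnegative coefficients is Lorentzian if and only if the sequence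
of coefficients form an ultra log-concave sequence with no internal zeros."

## What is here (`M : Matroid σ`, `n = Fintype.card σ`)

* `pottsNum q M k = Z^k_{q,M}(1, …, 1) = Σ_{|A|=k} q^{-rk(A)}` and `tutteCoeff q M k = c_q^k(M) = Σ_{|A|=k} q^{rk(σ)-rk(A)}`,
  with `tutteCoeff_eq_mul_pottsNum` (`c_q^k = q^{rk σ} Z^k_{q,M}(𝟙)` for `q ≠ 0`);
* `rename_toBivariate_pottsPoly` (`Z_{q,M}(X_1, X_0, …, X_0) = Σ_k Z^k_{q,M}(𝟙) X_0^k X_1^{n-k}`),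
  `bivariate_pottsNum_mem_lorentzian`, **`isUltraLogConcave_pottsNum`**, `hasNoInternalZeros_pottsNum`;
* `IsUltraLogConcave.const_mul` and **`isUltraLogConcave_tutteCoeff`** (the printed remark, `0 < q ≤ 1`);
* §4 the endpoint `q = 0` when `M.E = univ`: `tutteCoeff_zero_eq_card` (`c_0^k` counts the `k`-sets of full rank),
  `matroidRank_eq_iff_spanning`, `card_spanning_eq_indepNum_dual` (complements of spanning sets are the independent sets
  of `M✶`), `IsUltraLogConcave.reflect`, **`isUltraLogConcave_tutteCoeff_zero`** (via Thm. 4.14 for `M✶`).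

Two definitions with bodies (`pottsNum`, `tutteCoeff`), theorems otherwise; no `sorry`, no named fact (net debt 0).

## References

* [BrandenHuh2019] P. Brändén, J. Huh, *Lorentzian polynomials*, Ann. of Math. (2) 192 (2020) 821–891, arXiv:1902.03719 —
  §4.3 Thm. 4.10, proof of Thm. 4.14, and the remark on the Tutte polynomial after it; §2.4 Example 2.26.
-/

noncomputable section

open MvPolynomial Finsupp Finset
open scoped Nat

namespace Literature.Combinatorics.LorentzianPolynomials

variable {σ : Type*} [Fintype σ]

/-! ## §1 The numbers `Z^k_{q,M}(1, …, 1)` and `c_q^k(M)` -/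

/-- **`Z^k_{q,M}(1, …, 1) = Σ_{A ∈ [n choose k]} q^{-rk_M(A)}`**, the coefficient sum of the degree-`k` part of `Z_{q,M}`.
[cite: BrandenHuh2019, §4.3 (definition of `Z^k_{q,M}`)] -/
def pottsNum (q : ℝ) (M : Matroid σ) (k : ℕ) : ℝ :=
  ∑ A ∈ (univ : Finset σ).powersetCard k, q⁻¹ ^ matroidRank M (A : Set σ)

/-- **`c_q^k(M) = Σ_{A ∈ [n choose k]} q^{rk_M([n]) - rk_M(A)}`**, the coefficient of `w^k` in `w^{rk[n]} T_M(1 + q/w, 1 + w)`.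
[cite: BrandenHuh2019, §4.3 (remark after Thm. 4.14)] -/
def tutteCoeff (q : ℝ) (M : Matroid σ) (k : ℕ) : ℝ :=
  ∑ A ∈ (univ : Finset σ).powersetCard k, q ^ (matroidRank M (Set.univ : Set σ) - matroidRank M (A : Set σ))

/-- Unfolding `pottsNum`. [cite: BrandenHuh2019, §4.3] -/
theorem pottsNum_def (q : ℝ) (M : Matroid σ) (k : ℕ) :
    pottsNum q M k = ∑ A ∈ (univ : Finset σ).powersetCard k, q⁻¹ ^ matroidRank M (A : Set σ) := rfl

/-- Unfolding `tutteCoeff`. [cite: BrandenHuh2019, §4.3 (remark after Thm. 4.14)] -/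
theorem tutteCoeff_def (q : ℝ) (M : Matroid σ) (k : ℕ) :
    tutteCoeff q M k =
      ∑ A ∈ (univ : Finset σ).powersetCard k, q ^ (matroidRank M (Set.univ : Set σ) - matroidRank M (A : Set σ)) := rfl

/-- `Z^k_{q,M}(𝟙) ≥ 0` for `q ≥ 0`. [cite: BrandenHuh2019, §4.3] -/
theorem pottsNum_nonneg {q : ℝ} (hq : 0 ≤ q) (M : Matroid σ) (k : ℕ) : 0 ≤ pottsNum q M k :=
  Finset.sum_nonneg fun _ _ ↦ pow_nonneg (inv_nonneg.2 hq) _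

/-- **`c_q^k(M) = q^{rk_M([n])} · Z^k_{q,M}(1, …, 1)`** for `q ≠ 0` (`rk(A) ≤ rk([n])`). [cite: BrandenHuh2019, §4.3 (remark
after Thm. 4.14)] -/
theorem tutteCoeff_eq_mul_pottsNum {q : ℝ} (hq : q ≠ 0) (M : Matroid σ) (k : ℕ) :
    tutteCoeff q M k = q ^ matroidRank M (Set.univ : Set σ) * pottsNum q M k := by
  rw [tutteCoeff, pottsNum, Finset.mul_sum]
  refine Finset.sum_congr rfl fun A _ ↦ ?_
  rw [pow_sub₀ q hq (matroidRank_mono M (Set.subset_univ _)), inv_pow]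

/-! ## §2 Setting `w_1 = ⋯ = w_n` in `Z_{q,M}` -/

/-- `Z_{q,M}(X_1, X_0, …, X_0) = Σ_{A ⊆ σ} q^{-rk(A)} X_0^{|A|} X_1^{n-|A|}`. [cite: BrandenHuh2019, §4.3 proof of Thm. 4.14
("setting `w_1 = ⋯ = w_n`")] -/
theorem rename_toBivariate_pottsPoly_eq_sum (q : ℝ) (M : Matroid σ) :
    rename toBivariate (pottsPoly q M) =
      ∑ A : Finset σ, monomial (bideg A.card (Fintype.card σ - A.card)) (q⁻¹ ^ matroidRank M (A : Set σ)) := by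
  rw [pottsPoly_def, map_sum]
  refine Finset.sum_congr rfl fun A _ ↦ ?_
  rw [rename_monomial, mapDomain_toBivariate_homIndSet, Set.ncard_coe_finset]

/-- **The coefficient of `X_0^k X_1^{n-k}` in `Z_{q,M}(X_1, X_0, …, X_0)` is `Z^k_{q,M}(1, …, 1)`**.
[cite: BrandenHuh2019, §4.3 proof of Thm. 4.14 ("the sequence of coefficients")] -/
theorem coeff_rename_toBivariate_pottsPoly (q : ℝ) (M : Matroid σ) (k : ℕ) :
    coeff (bideg k (Fintype.card σ - k)) (rename toBivariate (pottsPoly q M)) = pottsNum q M k := by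
  rw [rename_toBivariate_pottsPoly_eq_sum, coeff_sum, pottsNum, Finset.powersetCard_eq_filter, Finset.powerset_univ,
    Finset.sum_filter]
  refine Finset.sum_congr rfl fun A _ ↦ ?_
  rw [coeff_monomial]
  refine if_congr ⟨fun h ↦ (bideg_eq_bideg_iff.1 h).1, fun h ↦ by rw [h]⟩ rfl rfl

/-- **`Z_{q,M}(X_1, X_0, …, X_0) = Σ_k Z^k_{q,M}(𝟙) X_0^k X_1^{n-k}`** — the bivariate polynomial obtained from `Z_{q,M}` by
setting `w_1 = ⋯ = w_n`. [cite: BrandenHuh2019, §4.3 proof of Thm. 4.14] -/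
theorem rename_toBivariate_pottsPoly (q : ℝ) (M : Matroid σ) :
    rename toBivariate (pottsPoly q M) = bivariate (Fintype.card σ) (pottsNum q M) := by
  have hhom : (rename toBivariate (pottsPoly q M)).IsHomogeneous (Fintype.card σ) :=
    (isHomogeneous_pottsPoly q M).rename_isHomogeneous
  rw [eq_bivariate_of_isHomogeneous hhom, bivariate_def, bivariate_def]
  refine Finset.sum_congr rfl fun k _ ↦ ?_
  rw [coeff_rename_toBivariate_pottsPoly q M k]

/-- **The bivariate polynomial `Σ_k Z^k_{q,M}(𝟙) X_0^k X_1^{n-k}` is Lorentzian for `0 < q ≤ 1`** (Thm. 4.10 + Thm. 2.10).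
[cite: BrandenHuh2019, §4.3 Thm. 4.10 with the proof of Thm. 4.14] -/
theorem bivariate_pottsNum_mem_lorentzian (M : Matroid σ) {q : ℝ} (hq : 0 < q) (hq1 : q ≤ 1) :
    bivariate (Fintype.card σ) (pottsNum q M) ∈ lorentzian (Fin 2) (Fintype.card σ) := by
  classical
  rw [← rename_toBivariate_pottsPoly]
  exact rename_mem_lorentzian_of_any toBivariate (pottsPoly_mem_lorentzian M hq hq1)

/-! ## §3 Ultra log-concavity -/

/-- **The numbers `Z^k_{q,M}(1, …, 1) = Σ_{|A|=k} q^{-rk(A)}`, `k = 0, …, n`, form an ultra log-concave sequence** for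
`0 < q ≤ 1`. [cite: BrandenHuh2019, §4.3 Thm. 4.10 with the remark after Thm. 4.14; §2.4 Example 2.26] -/
theorem isUltraLogConcave_pottsNum (M : Matroid σ) {q : ℝ} (hq : 0 < q) (hq1 : q ≤ 1) :
    IsUltraLogConcave (Fintype.card σ) (pottsNum q M) :=
  ((bivariate_mem_lorentzian_iff fun k _ ↦ pottsNum_nonneg hq.le M k).1 (bivariate_pottsNum_mem_lorentzian M hq hq1)).1

/-- … and have no internal zeros. [cite: BrandenHuh2019, §4.3 proof of Thm. 4.14; §2.4 Example 2.26] -/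
theorem hasNoInternalZeros_pottsNum (M : Matroid σ) {q : ℝ} (hq : 0 < q) (hq1 : q ≤ 1) :
    HasNoInternalZeros (Fintype.card σ) (pottsNum q M) :=
  ((bivariate_mem_lorentzian_iff fun k _ ↦ pottsNum_nonneg hq.le M k).1 (bivariate_pottsNum_mem_lorentzian M hq hq1)).2

omit [Fintype σ] in
/-- Ultra log-concavity is invariant under multiplication by a constant. [cite: BrandenHuh2019, §2.4 Example 2.26] -/
theorem IsUltraLogConcave.const_mul {d : ℕ} {a : ℕ → ℝ} (h : IsUltraLogConcave d a) (c : ℝ) :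
    IsUltraLogConcave d fun k ↦ c * a k := by
  intro k hk hkd
  have h1 := h k hk hkd
  have e1 : c * a (k - 1) / (d.choose (k - 1) : ℝ) * (c * a (k + 1) / (d.choose (k + 1) : ℝ)) =
      c ^ 2 * (a (k - 1) / (d.choose (k - 1) : ℝ) * (a (k + 1) / (d.choose (k + 1) : ℝ))) := by ring
  have e2 : (c * a k / (d.choose k : ℝ)) ^ 2 = c ^ 2 * (a k / (d.choose k : ℝ)) ^ 2 := by ring
  rw [e1, e2]
  exact mul_le_mul_of_nonneg_left h1 (sq_nonneg c)

/-- **Brändén–Huh (§4.3, after Thm. 4.14): the Tutte coefficients `c_q^k(M) = Σ_{|A|=k} q^{rk[n]-rk(A)}`, `k = 0, …, n`, form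
an ultra log-concave sequence** — here for `0 < q ≤ 1`, directly from Thm. 4.10. [cite: BrandenHuh2019, §4.3 (remark
after Thm. 4.14: "the sequence `c_q^k(M)` is ultra log-concave whenever `0 ≤ q ≤ 1`")] -/
theorem isUltraLogConcave_tutteCoeff (M : Matroid σ) {q : ℝ} (hq : 0 < q) (hq1 : q ≤ 1) :
    IsUltraLogConcave (Fintype.card σ) (tutteCoeff q M) := by
  have h := (isUltraLogConcave_pottsNum M hq hq1).const_mul (q ^ matroidRank M (Set.univ : Set σ))
  refine fun k hk hkd ↦ ?_
  have := h k hk hkd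
  simpa only [tutteCoeff_eq_mul_pottsNum hq.ne'] using this

/-- The displayed form: `c_q^k(M)² / C(n,k)² ≥ c_q^{k-1}(M)/C(n,k-1) · c_q^{k+1}(M)/C(n,k+1)` for `0 < k < n`.
[cite: BrandenHuh2019, §4.3 (remark after Thm. 4.14); §2.4 Example 2.26] -/
theorem tutteCoeff_sq_div_ge (M : Matroid σ) {q : ℝ} (hq : 0 < q) (hq1 : q ≤ 1) {k : ℕ} (hk : 0 < k)
    (hkn : k < Fintype.card σ) :
    (tutteCoeff q M (k - 1) / (Fintype.card σ).choose (k - 1)) * (tutteCoeff q M (k + 1) / (Fintype.card σ).choose (k + 1)) ≤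
      (tutteCoeff q M k / (Fintype.card σ).choose k) ^ 2 :=
  isUltraLogConcave_tutteCoeff M hq hq1 k hk hkn

/-! ## §4 The endpoint `q = 0`: spanning sets and the dual matroid -/

section Spanning

/-- **`c_0^k(M)` counts the `k`-subsets of full rank**: `c_0^k(M) = #{A : |A| = k, rk_M(A) = rk_M([n])}` (`0^0 = 1`,
`0^j = 0` for `j > 0`). [cite: BrandenHuh2019, §4.3 (remark after Thm. 4.14, the case `q = 0`)] -/
theorem tutteCoeff_zero_eq_card (M : Matroid σ) (k : ℕ) :
    tutteCoeff 0 M k = (((univ : Finset σ).powersetCard k).filter fun A : Finset σ ↦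
      matroidRank M (A : Set σ) = matroidRank M (Set.univ : Set σ)).card := by
  rw [tutteCoeff, ← Finset.sum_boole]
  refine Finset.sum_congr rfl fun A _ ↦ ?_
  have hle : matroidRank M (A : Set σ) ≤ matroidRank M (Set.univ : Set σ) := matroidRank_mono M (Set.subset_univ _)
  by_cases h : matroidRank M (A : Set σ) = matroidRank M (Set.univ : Set σ)
  · rw [if_pos h, h, Nat.sub_self, pow_zero]
  · rw [if_neg h, zero_pow (by omega)]

/-- Full rank means spanning (ground set `σ`): `rk_M(A) = rk_M(σ) ↔ M.Spanning A`.
[cite: BrandenHuh2019, §4.3 (remark after Thm. 4.14)] -/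
theorem matroidRank_eq_iff_spanning {M : Matroid σ} (hM : M.E = Set.univ) (A : Set σ) :
    matroidRank M A = matroidRank M (Set.univ : Set σ) ↔ M.Spanning A := by
  rw [Matroid.spanning_iff_eRk_le', hM, and_iff_left (Set.subset_univ _), ← Matroid.eRk_univ_eq, ← cast_matroidRank,
    ← cast_matroidRank, Nat.cast_le]
  constructor
  · exact fun h ↦ h.ge
  · exact fun h ↦ le_antisymm (matroidRank_mono M (Set.subset_univ _)) h

/-- Spanning sets are the complements of the independent sets of the dual (ground set `σ`).
[cite: BrandenHuh2019, §4.3 (remark after Thm. 4.14, `q = 0`); §4.3 Thm. 4.14] -/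
theorem spanning_iff_dual_indep_compl [DecidableEq σ] {M : Matroid σ} (hM : M.E = Set.univ) (A : Finset σ) :
    M.Spanning (A : Set σ) ↔ M✶.Indep ((Aᶜ : Finset σ) : Set σ) := by
  rw [Matroid.spanning_iff_compl_coindep (by rw [hM]; exact Set.subset_univ _), Matroid.coindep_def, hM,
    Finset.coe_compl, Set.compl_eq_univ_sdiff]

/-- **The number of spanning `k`-sets of `M` is the number of independent `(n-k)`-sets of `M✶`** (ground set `σ`).
[cite: BrandenHuh2019, §4.3 (remark after Thm. 4.14, `q = 0`); Thm. 4.14] -/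
theorem card_spanning_eq_indepNum_dual [DecidableEq σ] {M : Matroid σ} (hM : M.E = Set.univ) {k : ℕ}
    (hk : k ≤ Fintype.card σ) :
    (((univ : Finset σ).powersetCard k).filter fun A : Finset σ ↦
      matroidRank M (A : Set σ) = matroidRank M (Set.univ : Set σ)).card = indepNum M✶ (Fintype.card σ - k) := by
  classical
  rw [indepNum_def]
  rw [← Finset.card_image_of_injective _ (compl_injective : Function.Injective (compl : Finset σ → Finset σ))]
  congr 1
  ext I
  rw [Finset.mem_image, Finset.mem_filter, Finset.mem_powersetCard]
  constructor
  · rintro ⟨A, hA, rfl⟩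
    rw [Finset.mem_filter, Finset.mem_powersetCard] at hA
    refine ⟨⟨Finset.subset_univ _, by rw [Finset.card_compl, hA.1.2]⟩, ?_⟩
    exact (spanning_iff_dual_indep_compl hM A).1 ((matroidRank_eq_iff_spanning hM _).1 hA.2)
  · rintro ⟨⟨-, hI⟩, hind⟩
    refine ⟨Iᶜ, ?_, compl_compl I⟩
    rw [Finset.mem_filter, Finset.mem_powersetCard]
    refine ⟨⟨Finset.subset_univ _, ?_⟩, ?_⟩
    · rw [Finset.card_compl, hI]; omega
    · rw [matroidRank_eq_iff_spanning hM, spanning_iff_dual_indep_compl hM, compl_compl]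
      exact hind

omit [Fintype σ] in
/-- Ultra log-concavity of order `n` is symmetric under `k ↦ n - k` (`C(n,k) = C(n,n-k)`).
[cite: BrandenHuh2019, §2.4 Example 2.26] -/
theorem IsUltraLogConcave.reflect {n : ℕ} {a b : ℕ → ℝ} (h : IsUltraLogConcave n a) (hb : ∀ k ≤ n, b k = a (n - k)) :
    IsUltraLogConcave n b := by
  intro k hk hkn
  rw [hb (k - 1) (by omega), hb k (by omega), hb (k + 1) (by omega)]
  have h' := h (n - k) (by omega) (by omega)
  rw [show n - k - 1 = n - (k + 1) by omega, show n - k + 1 = n - (k - 1) by omega,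
    Nat.choose_symm (by omega : k + 1 ≤ n), Nat.choose_symm (by omega : k - 1 ≤ n),
    Nat.choose_symm (by omega : k ≤ n), mul_comm] at h'
  exact h'

/-- **The Tutte coefficients at `q = 0` are ultra log-concave** (ground set `σ`): `c_0^k(M)` = the number of spanning
`k`-sets of `M` = `I_{n-k}(M✶)`, and Thm. 4.14 for `M✶` with the symmetry `k ↦ n - k` — the endpoint `q = 0` of
"the sequence `c_q^k(M)` is ultra log-concave whenever `0 ≤ q ≤ 1`". [cite: BrandenHuh2019, §4.3 (remark after Thm. 4.14);
Thm. 4.14] -/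
theorem isUltraLogConcave_tutteCoeff_zero {M : Matroid σ} (hM : M.E = Set.univ) :
    IsUltraLogConcave (Fintype.card σ) (tutteCoeff 0 M) := by
  classical
  exact (isUltraLogConcave_indepNum M✶).reflect fun k hk ↦ by
    rw [tutteCoeff_zero_eq_card, card_spanning_eq_indepNum_dual hM hk]

end Spanning

end Literature.Combinatorics.LorentzianPolynomials

end
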